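import Mathlib
import Literature.Computability.AlgebraicComplexity.MatrixMultiplicationExponent

/-!
# `FidelityWitnesses.FidelityGapTwoSixExplicit` (stmt-MatrixMultiplication-14041) — vocabulary of the proof
# (robust weak border apolarity for `⟨2,2,2⟩` with a structural certificate)

Definitions only; no statement of the route is asserted here.  The item
`FidelityGapTwoSixExplicit : ∀ S, tensorRank S ≤ 6 → |Σ S·⟨2,2,2⟩|² ≤ (1 − 10⁻⁵)·8·Σ|S|²` is proved in the
sibling files `FidelityWitnessesFidelityGapTwoSixExplicit*.lean` along the following line (a quantitative
form of the `(210)`/`(120)` tests of weak border apolarity, Conner–Harper–Landsberg 2023 §3, for the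
annihilator `K = ⟨2,2,2⟩(C*)^⊥ ≅ U ⊗ sl(V) ⊗ W*` of the slices of `T = ⟨2,2,2⟩`):

* a rank-`≤ 6` tensor `S` yields (tree theorem `TensorApolarity.exists_subspace_of_algBorderRank_le`) a
  `10`-plane `F` of bilinear forms annihilating the slices of `S` with `dim F·A* ≤ 34`, `dim F·B* ≤ 34`;
  high fidelity of `S` against `T` makes `F` almost annihilate the slices of `T` (`sliceMap` small);
* `dim F·A* ≤ 34` says that the symmetrisation map `phiA` has a `≥ 6`-dimensional kernel on
  `F ⊗ A*` (`tensorSub F`); that kernel consists of alternating arrays and is then close to the explicit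
  `8`-dimensional space `kerSpan` (`= Λ²U ⊗ S³V* ⊗ W*`, basis `kerVec`, projection `kerProj`);
* testing that kernel against the `2`-plane `annT ⊓ perpTo F` (the part of `K` missing from `F`) through
  the explicit row vectors `rowVec b v` forces the `2`-plane to be close to `U ⊗ ĥ` (`uTensor · ĥ`) for a
  unit traceless `ĥ ∈ sl(V) ⊗ W*`; the `(120)` side (transported by the transpose symmetry of `⟨2,2,2⟩`)
  forces it close to `h̃ ⊗ W*`, and no `2`-plane is close to both.

Index conventions are the tree's: a tensor is `S a b c` with `a` the output slot and `(b, c) ∈ P2 × P2`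
the `A × B` slots (`matMulTensor`, `TensorApolarity.slicePerp`, `TensorApolarity.mulA`); an element of
`F ⊗ A*` is an array `z ((k, m), k')` on `(P2 × P2) × P2` (bilinear-form index `(k, m)`, extra `A`-index
`k'`), and `phiA z (k, (k', m)) = z ((k,m),k') + z ((k',m),k)` is `TensorApolarity.mulA` on pure tensors.
All metric statements use the standard Hermitian structures of `EuclideanSpace ℂ _`.

References: A. Conner, A. Harper, J. M. Landsberg, *New lower bounds for matrix multiplication and
`det₃`*, Forum Math. Pi 11 (2023) e17, §2.3, §3 [ConnerHarperLandsberg2023]; J. M. Landsberg, *The border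
rank of the multiplication of 2×2 matrices is seven*, J. Amer. Math. Soc. 19 (2006) [Landsberg2005].
What is NOT here: any theorem (the sibling files carry them).
-/

noncomputable section

namespace Summit.MatrixMultiplication.MatrixMultiplication.Theorems.GapTwoSixExplicit

-- single-conjunct summit: the `Summit.<S>.<P>` prefix repeats `MatrixMultiplication` by design (D-0017)
set_option linter.dupNamespace false

open scoped BigOperators ComplexConjugate
open Literature.Computability.AlgebraicComplexity

/-! ## Index types and ambient Hermitian spaces -/

/-- A slot index of `⟨2,2,2⟩`: pairs `(Fin 2 × Fin 2)` (the tree's `MatMulTwo.P2`). -/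
abbrev P2 : Type := Fin 2 × Fin 2

/-- Bilinear forms on `A × B` (coefficients on `P2 × P2`) with the standard Hermitian structure. -/
abbrev V16 : Type := EuclideanSpace ℂ (P2 × P2)

/-- The space `(A* ⊗ B*) ⊗ A*` of arrays `z ((k, m), k')`, standard Hermitian structure. -/
abbrev V64 : Type := EuclideanSpace ℂ ((P2 × P2) × P2)

/-- The space `sl(V) ⊗ W*`-with-trace: arrays `b (j, m)` on `Fin 2 × P2` (a `U`-component of a bilinear
form), standard Hermitian structure; the traceless ones (`traceless`) form `sl(V) ⊗ W*`. -/
abbrev V8 : Type := EuclideanSpace ℂ (Fin 2 × P2)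

/-- `⟨2,2,2⟩` over `ℂ` in the tree's slot order `T2 a b c` (`a` = output). -/
abbrev T2 : P2 → P2 → P2 → ℂ := matMulTensor ℂ 2 2 2

/-! ## The fixed linear maps -/

/-- Contraction of the bilinear-form index with the slices of `T = ⟨2,2,2⟩`:
`sliceMap z (c, a) = Σ_{p} z (p, a) · T c p.1 p.2` (so `z ∈ K ⊗ A*` iff `sliceMap z = 0`, with
`K = T(C*)^⊥ = TensorApolarity.slicePerp T`). -/
def sliceMap : V64 →ₗ[ℂ] (P2 × P2 → ℂ) where
  toFun z := fun ca => ∑ p : P2 × P2, z (p, ca.2) * T2 ca.1 p.1 p.2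
  map_add' z z' := by
    funext ca
    simp only [PiLp.add_apply, Pi.add_apply, add_mul, Finset.sum_add_distrib]
  map_smul' c z := by
    funext ca
    simp only [PiLp.smul_apply, smul_eq_mul, Pi.smul_apply, RingHom.id_apply, Finset.mul_sum, mul_assoc]

/-- The `(210)`-symmetrisation map on `(A* ⊗ B*) ⊗ A*`:
`phiA z (k, (k', m)) = z ((k, m), k') + z ((k', m), k)`; on a pure tensor `f ⊗ α` it is
`TensorApolarity.mulA f α`, so `phiA (tensorSub F) = TensorApolarity.prodA F`. -/
def phiA : V64 →ₗ[ℂ] (P2 × (P2 × P2) → ℂ) where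
  toFun z := fun q => z ((q.1, q.2.2), q.2.1) + z ((q.2.1, q.2.2), q.1)
  map_add' z z' := by
    funext q
    simp only [PiLp.add_apply, Pi.add_apply]
    ring
  map_smul' c z := by
    funext q
    simp only [PiLp.smul_apply, smul_eq_mul, Pi.smul_apply, RingHom.id_apply]
    ring

/-- `F ⊗ A*` inside `(A* ⊗ B*) ⊗ A*`: arrays all of whose `A`-slices `z (·, a)` lie in `F`. -/
def tensorSub (F : Submodule ℂ (P2 × P2 → ℂ)) : Submodule ℂ V64 where
  carrier := {z | ∀ a : P2, (fun p => z (p, a)) ∈ F}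
  add_mem' {z z'} hz hz' a := by
    have h := F.add_mem (hz a) (hz' a)
    exact h
  zero_mem' a := by
    have h := F.zero_mem
    exact h
  smul_mem' c z hz a := by
    have h := F.smul_mem c (hz a)
    exact h

/-- The array `ℓ ⊗ e_a ∈ (A* ⊗ B*) ⊗ A*` (the bilinear form `ℓ` placed in the `A`-slice `a`). -/
def slotVec (ℓ : V16) (a : P2) : V64 :=
  WithLp.toLp 2 fun q => if q.2 = a then ℓ q.1 else 0

/-- `K = T(C*)^⊥`: bilinear forms annihilating every slice of `T = ⟨2,2,2⟩`
(`TensorApolarity.slicePerp T2` as a subspace of `V16`; dimension `12`, `≅ U ⊗ sl(V) ⊗ W*`). -/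
def annT : Submodule ℂ V16 where
  carrier := {ℓ | ∀ c : P2, ∑ p : P2 × P2, ℓ p * T2 c p.1 p.2 = 0}
  add_mem' {ℓ ℓ'} hℓ hℓ' c := by
    simp only [PiLp.add_apply, add_mul, Finset.sum_add_distrib, hℓ c, hℓ' c, add_zero]
  zero_mem' c := by simp
  smul_mem' x ℓ hℓ c := by
    simp only [PiLp.smul_apply, smul_eq_mul, mul_assoc, ← Finset.mul_sum, hℓ c, mul_zero]

/-- The Hermitian orthogonal complement in `V16` of a space `F` of bilinear forms given in plain
coordinates: `ℓ` with `Σ_p conj (ℓ p) · f p = 0` for all `f ∈ F`. -/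
def perpTo (F : Submodule ℂ (P2 × P2 → ℂ)) : Submodule ℂ V16 where
  carrier := {ℓ | ∀ f ∈ F, ∑ p : P2 × P2, conj (ℓ p) * f p = 0}
  add_mem' {ℓ ℓ'} hℓ hℓ' f hf := by
    simp only [PiLp.add_apply, map_add, add_mul, Finset.sum_add_distrib, hℓ f hf, hℓ' f hf, add_zero]
  zero_mem' f hf := by simp
  smul_mem' x ℓ hℓ f hf := by
    simp only [PiLp.smul_apply, smul_eq_mul, map_mul, mul_assoc, ← Finset.mul_sum, hℓ f hf, mul_zero]

/-! ## The explicit kernel `Λ²U ⊗ S³V* ⊗ W*` of `phiA` on `K ⊗ A*` -/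

/-- The alternating sign on the two `U`-indices: `ε(0,1) = 1`, `ε(1,0) = -1`, `0` on the diagonal. -/
def epsU (i i' : Fin 2) : ℤ :=
  if i = 0 ∧ i' = 1 then 1 else if i = 1 ∧ i' = 0 then -1 else 0

/-- The four integer arrays `ζ_s (j, j', j'')` on `V* ⊗ V ⊗ V*` encoding the cubics `x³, x²y, xy², y³`
(symmetric in `(j, j'')`, traceless in `(j, j')`): `ζ₀ = e₀₁₀`, `ζ₁ = e₀₁₁ + e₁₁₀ − e₀₀₀`,
`ζ₂ = e₁₁₁ − e₀₀₁ − e₁₀₀`, `ζ₃ = −e₁₀₁`. -/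
def zetaTab (s : Fin 4) (q : Fin 2 × Fin 2 × Fin 2) : ℤ :=
  if s = 0 then (if q = (0, 1, 0) then 1 else 0)
  else if s = 1 then (if q = (0, 1, 1) ∨ q = (1, 1, 0) then 1 else if q = (0, 0, 0) then -1 else 0)
  else if s = 2 then (if q = (1, 1, 1) then 1 else if q = (0, 0, 1) ∨ q = (1, 0, 0) then -1 else 0)
  else (if q = (1, 0, 1) then -1 else 0)

/-- The integer table of the eight kernel vectors, indexed by `(w, s) ∈ Fin 2 × Fin 4` (`w` = the passive
`W*`-index, `s` = the cubic): at `((k, m), k')`,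
`ε(k.1, k'.1) · ζ_s (k.2, m.1, k'.2) · [m.2 = w]`. -/
def kerTab (ws : Fin 2 × Fin 4) (p : (P2 × P2) × P2) : ℤ :=
  epsU p.1.1.1 p.2.1 * zetaTab ws.2 (p.1.1.2, p.1.2.1, p.2.2) * (if p.1.2.2 = ws.1 then 1 else 0)

/-- The eight kernel vectors `n_{w,s} ∈ (A* ⊗ B*) ⊗ A*` (pairwise orthogonal, square norms `kerNsq`). -/
def kerVec (ws : Fin 2 × Fin 4) : V64 :=
  WithLp.toLp 2 fun p => ((kerTab ws p : ℤ) : ℂ)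

/-- Square norms of the kernel vectors: `2` for the cubics `x³, y³`, `6` for `x²y, xy²`. -/
def kerNsq (ws : Fin 2 × Fin 4) : ℕ :=
  if ws.2 = 0 ∨ ws.2 = 3 then 2 else 6

/-- The `8`-plane `𝒩 = Λ²U ⊗ S³V* ⊗ W*` spanned by the kernel vectors. -/
def kerSpan : Submodule ℂ V64 :=
  Submodule.span ℂ (Set.range kerVec)

/-- The orthogonal projection onto `kerSpan`, in closed form:
`kerProj z = Σ_{w,s} (⟪n_{w,s}, z⟫ / ‖n_{w,s}‖²) • n_{w,s}`. -/
def kerProj : V64 →ₗ[ℂ] V64 :=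
  ∑ ws : Fin 2 × Fin 4,
    (1 / (kerNsq ws : ℂ)) • (innerₛₗ ℂ (kerVec ws) : V64 →ₗ[ℂ] ℂ).smulRight (kerVec ws)

/-! ## `U`-components, traceless parts, row vectors -/

/-- `sl(V) ⊗ W* ⊂ V8`: the arrays `b (j, (j', w))` traceless in `(j, j')` for each `w`. -/
def traceless : Submodule ℂ V8 where
  carrier := {b | ∀ w : Fin 2, b (0, (0, w)) + b (1, (1, w)) = 0}
  add_mem' {b b'} hb hb' w := by
    simp only [PiLp.add_apply]
    have h1 := hb w
    have h2 := hb' w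
    linear_combination h1 + h2
  zero_mem' w := by simp
  smul_mem' c b hb w := by
    simp only [PiLp.smul_apply, smul_eq_mul]
    have h1 := hb w
    linear_combination c * h1

/-- The `i`-th `U`-component of a bilinear form: `hComp i ℓ (j, m) = ℓ ((i, j), m)`
(so `ℓ = Σ_i u_i ⊗ hComp i ℓ`, and `ℓ ∈ annT` iff both components are traceless). -/
def hComp (i : Fin 2) (ℓ : V16) : V8 :=
  WithLp.toLp 2 fun q => ℓ ((i, q.1), q.2)

/-- `u_i ⊗ h`: the bilinear form with `i`-th `U`-component `h` and the other component `0`. -/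
def uTensor (i : Fin 2) (h : V8) : V16 :=
  WithLp.toLp 2 fun p => if p.1.1 = i then h (p.1.2, p.2) else 0

/-- The row vector of `b ∈ sl(V) ⊗ W*` at the `V*`-index `v`: the array `u₀ ⊗ b ⊗ e_{(1, v)}`, i.e.
`rowVec b v ((k, m), k') = [k.1 = 0] · [k' = (1, v)] · b (k.2, m)`.  Testing the kernel against
`uTensor i b ⊗ e_a` reduces to testing it against these rows. -/
def rowVec (b : V8) (v : Fin 2) : V64 :=
  WithLp.toLp 2 fun q => if q.1.1.1 = 0 ∧ q.2 = (1, v) then b (q.1.1.2, q.1.2) else 0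


/-! ## The transpose symmetry of `⟨2,2,2⟩` (swaps the `(210)` and `(120)` tests) -/

/-- The index involution of the symmetry `(X, Y) ↦ (Yᵀ, Xᵀ)` of matrix multiplication on bilinear-form
indices: `(k, m) ↦ (mᵀ, kᵀ)` with `(x, y)ᵀ = (y, x)`.  `T = ⟨2,2,2⟩` is invariant:
`T2 aᵀ mᵀ kᵀ = T2 a k m`. -/
def swapTr : P2 × P2 ≃ P2 × P2 where
  toFun p := (p.2.swap, p.1.swap)
  invFun p := (p.2.swap, p.1.swap)
  left_inv p := by simp
  right_inv p := by simp

/-- The companion index bijection on `(210)`/`(120)` arrays: `(k, (k', m)) ↦ (mᵀ, (kᵀ, k'ᵀ))`, under which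
`TensorApolarity.mulA (f ∘ swapTr) α = TensorApolarity.mulB f (α ∘ swap) ∘ arrTr`. -/
def arrTr : P2 × (P2 × P2) ≃ P2 × (P2 × P2) where
  toFun q := (q.2.2.swap, (q.1.swap, q.2.1.swap))
  invFun q := (q.2.1.swap, (q.2.2.swap, q.1.swap))
  left_inv q := by simp
  right_inv q := by simp

end Summit.MatrixMultiplication.MatrixMultiplication.Theorems.GapTwoSixExplicit

end
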